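import Mathlib.RingTheory.Ideal.Colon
import Mathlib.RingTheory.Ideal.MinimalPrime.Basic
import Mathlib.RingTheory.Ideal.KrullsHeightTheorem
import Mathlib.RingTheory.LocalRing.MaximalIdeal.Basic
import HarnessLib

/-!
# Socles of local rings modulo non-zero-divisors; exchanging a parameter

Tools for Matsumura, *Commutative Ring Theory*, Thm. 18.1 ((1) ⇒ (5'): a regular local ring is
Gorenstein, i.e. `A/𝔮` has a simple socle for every ideal `𝔮` generated by a system of
parameters), proved in `Literature.RingTheory.RegularLocalRing.ParameterIdealSocle` by an
elementary exchange argument whose two ingredients live here, for a local ring `(P, 𝔪)` and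
socles written as colon ideals `(I : 𝔪) ⊆ P` (Mathlib's `Submodule.colon`):

* `exists_colon_eq_sup_span_swap` — for `f, g ∈ 𝔪` non-zero-divisors modulo an ideal `𝔟`,
  the socle of `P/((f) + 𝔟)` is cyclic iff the socle of `P/((g) + 𝔟)` is: multiplication by
  `g` identifies the socle of `B/fB` with that of `B/fgB` (`B = P/𝔟`,
  `exists_sub_mul_mem_of_mem_colon`), which is symmetric in `f, g`. This is the classical
  `Hom_B(k, B/fB) ≅ Ext¹_B(k, B)` (Bruns–Herzog, *Cohen–Macaulay rings*, Lemma 1.2.4; Rees),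
  made explicit and `Ext`-free.
* `exists_pow_le_span_sup_of_forall_notMem` — exchanging a parameter keeps the ideal
  `𝔪`-primary: if `(a) + 𝔟` is `𝔪`-primary with `a ∈ 𝔪` and `g` avoids the minimal primes of
  `𝔟`, then `(g) + 𝔟` is `𝔪`-primary (Krull's principal ideal theorem in `P/𝔮`, Matsumura
  Thm. 13.5, in Mathlib's form `Ideal.map_height_le_one_of_mem_minimalPrimes`).
* `colon_le_of_lt` — if `P/I` is local Artinian with cyclic socle, every ideal strictly above
  `I` contains the socle ("the unique minimal non-zero ideal", de Smit–Rubin–Schoof,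
  *Criteria for complete intersections*, Cor. 2.2).

Everything here is proved; no definitions, no named facts.

## References

* H. Matsumura, *Commutative Ring Theory*, CUP 1986, Thm. 13.5, Thm. 18.1. [Matsumura1987]
* W. Bruns, J. Herzog, *Cohen–Macaulay rings*, CUP 1998, Lemma 1.2.4, 3.2.10. [BrunsHerzog1998]
* B. de Smit, K. Rubin, R. Schoof, *Criteria for complete intersections*, in: Modular Forms and
  Fermat's Last Theorem, Springer 1997, Cor. 2.2. [DeSmitRubinSchoof1997]
-/

namespace Literature.RingTheory.RegularLocalRing

universe u

open IsLocalRing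

variable {P : Type u} [CommRing P]

/-! ### The socle of `B/fB` does not depend on the non-zero-divisor `f` -/

section Swap

/-- An ideal is contained in its colon ideal `(I : S)` — DEPRECATED restatement of Mathlib's
`Ideal.le_colon` (librarian dedup-01366, 2026-08-16). [folklore] -/
@[deprecated Ideal.le_colon (since := "2026-08-16")]
theorem le_colon_self (I : Ideal P) (S : Set P) : I ≤ I.colon S := Ideal.le_colon

variable [IsLocalRing P]

/-- **Socle transfer along a non-zero-divisor** (the map `Hom(k, B/fB) → Hom(k, B/fgB)`,
`c ↦ gc`, is onto): for `f ∈ 𝔪` and `f, g` non-zero-divisors modulo `𝔟`, every `e` with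
`𝔪e ⊆ (fg) + 𝔟` is `≡ g c (mod 𝔟)` for some `c` with `𝔪c ⊆ (f) + 𝔟`.
[cite: BrunsHerzog1998, Lemma 1.2.4] -/
theorem exists_sub_mul_mem_of_mem_colon {𝔟 : Ideal P} {f g : P} (hf : f ∈ maximalIdeal P)
    (hfreg : ∀ a, f * a ∈ 𝔟 → a ∈ 𝔟) (hgreg : ∀ a, g * a ∈ 𝔟 → a ∈ 𝔟) {e : P}
    (he : e ∈ (Ideal.span {f * g} ⊔ 𝔟).colon (maximalIdeal P : Set P)) :
    ∃ c ∈ (Ideal.span {f} ⊔ 𝔟).colon (maximalIdeal P : Set P), e - g * c ∈ 𝔟 := by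
  have hef : e * f ∈ Ideal.span {f * g} ⊔ 𝔟 := Submodule.mem_colon.mp he f hf
  obtain ⟨a, b, hb, hab⟩ := Ideal.mem_span_singleton_sup.mp hef
  have hb₀ : e - g * a ∈ 𝔟 := by
    refine hfreg _ ?_
    have : f * (e - g * a) = b := by linear_combination -hab
    rw [this]
    exact hb
  refine ⟨a, Submodule.mem_colon.mpr fun m hm => ?_, hb₀⟩
  have hem := Submodule.mem_colon.mp he m hm
  rw [smul_eq_mul] at hem ⊢
  obtain ⟨a', b', hb', hab'⟩ := Ideal.mem_span_singleton_sup.mp hem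
  -- `g (a m - a' f) = b' - (e - g a) m ∈ 𝔟`
  have hmem : a * m - a' * f ∈ 𝔟 := by
    refine hgreg _ ?_
    have : g * (a * m - a' * f) = b' - (e - g * a) * m := by linear_combination -hab'
    rw [this]
    exact 𝔟.sub_mem hb' (𝔟.mul_mem_right _ hb₀)
  exact Ideal.mem_span_singleton_sup.mpr ⟨a', a * m - a' * f, hmem, by ring⟩

/-- The easy direction: `𝔪c ⊆ (f) + 𝔟` implies `𝔪gc ⊆ (fg) + 𝔟`. [folklore] -/
theorem mul_mem_colon_span_mul_sup {𝔟 : Ideal P} {f : P} (g : P) {c : P}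
    (hc : c ∈ (Ideal.span {f} ⊔ 𝔟).colon (maximalIdeal P : Set P)) :
    g * c ∈ (Ideal.span {f * g} ⊔ 𝔟).colon (maximalIdeal P : Set P) := by
  refine Submodule.mem_colon.mpr fun m hm => ?_
  obtain ⟨a, b, hb, hab⟩ := Ideal.mem_span_singleton_sup.mp (Submodule.mem_colon.mp hc m hm)
  rw [smul_eq_mul] at hab ⊢
  exact Ideal.mem_span_singleton_sup.mpr ⟨a, g * b, 𝔟.mul_mem_left g hb,
    by linear_combination g * hab⟩

/-- **The socle of `B/fB` is cyclic iff the socle of `B/gB` is**, for non-zero-divisors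
`f, g ∈ 𝔪` modulo `𝔟` (`B = P/𝔟`): both are isomorphic to the socle of `B/fgB`
(`Hom_B(k, B/fB) ≅ Ext¹_B(k, B) ≅ Hom_B(k, B/gB)`). Stated for the preimages in `P`:
if `((f) + 𝔟 : 𝔪) = (f) + 𝔟 + (s)` then `((g) + 𝔟 : 𝔪) = (g) + 𝔟 + (s')` for some `s'`.
[cite: BrunsHerzog1998, Lemma 1.2.4] -/
theorem exists_colon_eq_sup_span_swap {𝔟 : Ideal P} {f g : P} (hf : f ∈ maximalIdeal P)
    (hg : g ∈ maximalIdeal P) (hfreg : ∀ a, f * a ∈ 𝔟 → a ∈ 𝔟)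
    (hgreg : ∀ a, g * a ∈ 𝔟 → a ∈ 𝔟) {s : P}
    (hs : (Ideal.span {f} ⊔ 𝔟).colon (maximalIdeal P : Set P) =
      (Ideal.span {f} ⊔ 𝔟) ⊔ Ideal.span {s}) :
    ∃ s', (Ideal.span {g} ⊔ 𝔟).colon (maximalIdeal P : Set P) =
      (Ideal.span {g} ⊔ 𝔟) ⊔ Ideal.span {s'} := by
  -- `s` is a socle element of `(f) + 𝔟`, so `g s` is one of `(fg) + 𝔟 = (gf) + 𝔟`
  have hs_mem : s ∈ (Ideal.span {f} ⊔ 𝔟).colon (maximalIdeal P : Set P) := by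
    rw [hs]
    exact Ideal.mem_sup_right (Ideal.mem_span_singleton_self s)
  have hgs : g * s ∈ (Ideal.span {g * f} ⊔ 𝔟).colon (maximalIdeal P : Set P) := by
    rw [mul_comm g f]
    exact mul_mem_colon_span_mul_sup g hs_mem
  -- hence `g s ≡ f c₀` with `c₀` a socle element of `(g) + 𝔟`; this `c₀` generates
  obtain ⟨c₀, hc₀, hc₀'⟩ := exists_sub_mul_mem_of_mem_colon hg hgreg hfreg hgs
  refine ⟨c₀, le_antisymm ?_ ?_⟩
  · intro d hd
    have hfd : f * d ∈ (Ideal.span {f * g} ⊔ 𝔟).colon (maximalIdeal P : Set P) := by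
      rw [mul_comm f g]
      exact mul_mem_colon_span_mul_sup f hd
    obtain ⟨c, hc, hc'⟩ := exists_sub_mul_mem_of_mem_colon hf hfreg hgreg hfd
    rw [hs] at hc
    obtain ⟨y, hy, z, hz, rfl⟩ := Submodule.mem_sup.mp hc
    obtain ⟨a, b, hb, rfl⟩ := Ideal.mem_span_singleton_sup.mp hy
    obtain ⟨t, rfl⟩ := Ideal.mem_span_singleton'.mp hz
    -- `f (d - g a - t c₀) ∈ 𝔟`
    have hmem : d - g * a - t * c₀ ∈ 𝔟 := by
      refine hfreg _ ?_
      have : f * (d - g * a - t * c₀) =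
          (f * d - g * (a * f + b + t * s)) + g * b + t * (g * s - f * c₀) := by ring
      rw [this]
      exact 𝔟.add_mem (𝔟.add_mem hc' (𝔟.mul_mem_left g hb)) (𝔟.mul_mem_left t hc₀')
    refine Submodule.mem_sup.mpr ⟨a * g + (d - g * a - t * c₀),
      Ideal.mem_span_singleton_sup.mpr ⟨a, _, hmem, rfl⟩, t * c₀,
      Ideal.mem_span_singleton'.mpr ⟨t, rfl⟩, by ring⟩
  · exact sup_le Ideal.le_colon ((Ideal.span_singleton_le_iff_mem _).mpr hc₀)

end Swap

/-! ### Exchanging one parameter -/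

section Exchange

variable [IsLocalRing P] [IsNoetherianRing P]

/-- **Exchange keeps the ideal `𝔪`-primary.** If `(a) + 𝔟` is `𝔪`-primary (`a ∈ 𝔪`) and
`g` lies in no minimal prime of `𝔟`, then `(g) + 𝔟` is `𝔪`-primary (or everything): a prime
`Q ⊇ (g) + 𝔟` strictly contains a minimal prime `𝔮` of `𝔟`, and in the domain `P/𝔮` the
maximal ideal is minimal over the principal ideal `(ā)`, hence of height `≤ 1` (Krull), so
`Q = 𝔪`. [cite: Matsumura1987, Thm. 13.5 and Thm. 14.1] -/
theorem exists_pow_le_span_sup_of_forall_notMem {𝔟 : Ideal P} {a g : P}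
    (ha : a ∈ maximalIdeal P) {N : ℕ}
    (hN : maximalIdeal P ^ N ≤ Ideal.span {a} ⊔ 𝔟)
    (havoid : ∀ 𝔮 ∈ 𝔟.minimalPrimes, g ∉ 𝔮) :
    ∃ N', maximalIdeal P ^ N' ≤ Ideal.span {g} ⊔ 𝔟 := by
  refine Ideal.exists_pow_le_of_le_radical_of_fg ?_ (IsNoetherian.noetherian _)
  rw [Ideal.radical_eq_sInf]
  refine le_sInf fun Q ⟨hJQ, hQ⟩ => ?_
  have h𝔟Q : 𝔟 ≤ Q := le_sup_right.trans hJQ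
  have hgQ : g ∈ Q := hJQ (Ideal.mem_sup_left (Ideal.mem_span_singleton_self g))
  obtain ⟨𝔮, h𝔮, h𝔮Q⟩ := Ideal.exists_minimalPrimes_le h𝔟Q
  haveI h𝔮p : 𝔮.IsPrime := h𝔮.1.1
  have hlt : 𝔮 < Q := lt_of_le_of_ne h𝔮Q fun h => havoid 𝔮 h𝔮 (h ▸ hgQ)
  by_contra hQ𝔪
  have hQlt : Q < maximalIdeal P := lt_of_le_of_ne (le_maximalIdeal hQ.ne_top)
    fun h => hQ𝔪 (h ▸ le_rfl)
  -- in `P/𝔮`: the image of `𝔪` is minimal over `(ā)`, so has height `≤ 1`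
  have hmin : maximalIdeal P ∈ (𝔮 ⊔ Ideal.span {a}).minimalPrimes := by
    refine ⟨⟨inferInstance, sup_le (le_maximalIdeal h𝔮p.ne_top)
      ((Ideal.span_singleton_le_iff_mem _).mpr ha)⟩, fun 𝔭 ⟨h𝔭, hle𝔭⟩ _ => ?_⟩
    haveI := h𝔭
    refine Ideal.IsPrime.le_of_pow_le (n := N) (hN.trans (sup_le ?_ ?_))
    · exact le_sup_right.trans hle𝔭
    · exact (h𝔮.1.2.trans le_sup_left).trans hle𝔭
  have h1 := Ideal.map_height_le_one_of_mem_minimalPrimes hmin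
  set mk := Ideal.Quotient.mk 𝔮 with hmk
  have hker : ∀ {J : Ideal P}, 𝔮 ≤ J → (J.map mk).comap mk = J := fun hJ => by
    rw [Ideal.comap_map_of_surjective _ Ideal.Quotient.mk_surjective, ← RingHom.ker_eq_comap_bot,
      Ideal.mk_ker, sup_eq_left.mpr hJ]
  haveI hQ' : (Q.map mk).IsPrime :=
    Ideal.map_isPrime_of_surjective Ideal.Quotient.mk_surjective (by rwa [Ideal.mk_ker])
  haveI h𝔪' : ((maximalIdeal P).map mk).IsPrime :=
    Ideal.map_isPrime_of_surjective Ideal.Quotient.mk_surjective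
      (by rw [Ideal.mk_ker]; exact le_maximalIdeal h𝔮p.ne_top)
  have hbot : (⊥ : Ideal (P ⧸ 𝔮)) < Q.map mk := by
    refine bot_lt_iff_ne_bot.mpr fun h => hlt.ne (le_antisymm hlt.le ?_)
    rw [Ideal.map_eq_bot_iff_le_ker, Ideal.mk_ker] at h
    exact h
  have hlt' : Q.map mk < (maximalIdeal P).map mk := by
    refine lt_of_le_of_ne (Ideal.map_mono hQlt.le) fun h => hQlt.ne ?_
    rw [← hker hlt.le, h, hker (le_maximalIdeal h𝔮p.ne_top)]
  have h2 := Ideal.height_add_one_le_of_lt_of_isPrime hbot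
  have h3 := Ideal.height_add_one_le_of_lt_of_isPrime hlt'
  rw [Ideal.height_bot, zero_add] at h2
  have h4 : (1 : ℕ∞) + 1 ≤ 1 :=
    calc (1 : ℕ∞) + 1 ≤ (Q.map mk).height + 1 := by gcongr
      _ ≤ ((maximalIdeal P).map mk).height := h3
      _ ≤ 1 := h1
  exact absurd h4 (by decide)

end Exchange

/-! ### Consequences: ideals above a parameter ideal contain the socle -/

section Consequences

variable [IsLocalRing P]

/-- If `P/I` is local Artinian (`𝔪ᴺ ⊆ I`) with cyclic socle `(I : 𝔪) = I + (s)`, then every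
ideal strictly containing `I` contains the whole socle `(I : 𝔪)` ("the unique minimal non-zero
ideal", de Smit–Rubin–Schoof Cor. 2.2). [cite: DeSmitRubinSchoof1997, Cor. 2.2] -/
theorem colon_le_of_lt {I : Ideal P} {N : ℕ} (hN : maximalIdeal P ^ N ≤ I) {s : P}
    (hs : I.colon (maximalIdeal P : Set P) = I ⊔ Ideal.span {s}) {J : Ideal P} (hJ : I < J) :
    I.colon (maximalIdeal P : Set P) ≤ J := by
  classical
  obtain ⟨e₀, he₀J, he₀I⟩ := SetLike.exists_of_lt hJ
  -- the least `k` with `𝔪ᵏ e₀ ⊆ I`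
  have hex : ∃ k, maximalIdeal P ^ k * Ideal.span {e₀} ≤ I := ⟨N, Ideal.mul_le_right.trans hN⟩
  set k₀ := Nat.find hex with hk₀
  have hk₀spec : maximalIdeal P ^ k₀ * Ideal.span {e₀} ≤ I := Nat.find_spec hex
  have hk₀pos : k₀ ≠ 0 := fun h => by
    rw [h, pow_zero, one_mul, Ideal.span_singleton_le_iff_mem] at hk₀spec
    exact he₀I hk₀spec
  obtain ⟨k, hk⟩ := Nat.exists_eq_succ_of_ne_zero hk₀pos
  have hkmin : ¬ maximalIdeal P ^ k * Ideal.span {e₀} ≤ I :=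
    Nat.find_min hex (by rw [← hk₀]; omega)
  obtain ⟨e, he, heI⟩ := SetLike.not_le_iff_exists.mp hkmin
  -- `e` is a socle element of `P/I` lying in `J`
  have heJ : e ∈ J := (Ideal.mul_le_left.trans ((Ideal.span_singleton_le_iff_mem _).mpr he₀J)) he
  have hecol : e ∈ I.colon (maximalIdeal P : Set P) := by
    refine Submodule.mem_colon.mpr fun m hm => hk₀spec ?_
    rw [hk, pow_succ', mul_assoc, smul_eq_mul, mul_comm e m]
    exact Ideal.mul_mem_mul hm he
  -- write `e = i + t s`; then `t` is a unit, so `s ∈ J`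
  have hs_mem : s ∈ I.colon (maximalIdeal P : Set P) := by
    rw [hs]; exact Ideal.mem_sup_right (Ideal.mem_span_singleton_self s)
  rw [hs] at hecol ⊢
  obtain ⟨i, hi, z, hz, hiz⟩ := Submodule.mem_sup.mp hecol
  obtain ⟨t, rfl⟩ := Ideal.mem_span_singleton'.mp hz
  have ht : IsUnit t := by
    by_contra ht
    have htm : t ∈ maximalIdeal P := ht
    have : t * s ∈ I := by
      have := Submodule.mem_colon.mp hs_mem t htm
      rwa [smul_eq_mul, mul_comm] at this
    exact heI (hiz ▸ I.add_mem hi this)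
  have hsJ : s ∈ J := by
    obtain ⟨u, rfl⟩ := ht
    have : (u : P) * s = e - i := by rw [← hiz]; ring
    have h' : s = (↑u⁻¹ : P) * (e - i) := by rw [← this, Units.inv_mul_cancel_left]
    rw [h']
    exact J.mul_mem_left _ (J.sub_mem heJ (hJ.le hi))
  exact sup_le hJ.le ((Ideal.span_singleton_le_iff_mem _).mpr hsJ)

end Consequences

end Literature.RingTheory.RegularLocalRing
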